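import Literature.NumberTheory.Rogawski1990.CartanAlgebra
import HarnessLib

/-!
# The `⋆`-algebra `K[A]` of a `2 × 2` block without eigenvalues: a commutative domain inside `M₂(K)`, stable under the `G`-adjoint, with a
# non-scalar `⋆`-fixed square-root generator `κ` (`κ² = k₀`) — the quadratic field `K = (L′)^{α′}` of a TYPE (2) torus (Rogawski 1990, §3.6 p. 31)

Topic `NumberTheory/Rogawski1990`; namespace `Literature.NumberTheory.Rogawski1990`.  THEOREMS ONLY (no definition, no named fact, no instance, no
notation, no `sorry`).  Cell `pub/hodgecm-mathlib`, programme P3a, road «D-N7-inert» ([Rogawski1990, Prop. 4.9.1 (b)]), brick (L4a) «local class set»,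
TYPE (2): the ALGEBRA half, companion of ★ `StableClassesTypeTwoFrame` (the `(2,1)` block frame) and ★ `LinearAlgebra.Matrix.BlockCentralizerDisjointSpectra`
(B-p18 (g30): `exists_eq_smul_one_add_smul_of_commute`, the commutant of `A` is `K[A] = {α + βA}`).  HC_CM is proved only modulo the printed citations until
rung 0 closes; this file is unconditional `2 × 2` matrix algebra over a field `K` with an involution `σ`.

THE PRINT.  [Rogawski1990, §3.6 p. 31]: «Type (2): `T_K × E¹`, where `K` is a quadratic extension of `F` distinct from `E`»: `L′ = KE`, `α′` the automorphism of
`L′` of the second kind fixing `K`; [§3.5 Prop. 3.5.2 (a)] `H¹(F,T_K) ≅ K^×∕N_{L′∕K}(L′^×)`.  MODEL (`E ↝ K` a field with involution `σ`, `F ↝ K^σ`): `A ∈ M₂(K)`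
with `χ_A` WITHOUT roots, unitary for a `σ`-hermitian invertible `G ∈ M₂(K)` (`ᵗ(σA) G A = G`); `L′ ↝ K[A] = {α + βA}`, `α′ ↝ ⋆_G = hermStar σ G`.
* §1 `det (α + βA) = α² + αβ tr A + β² det A`, non-zero unless `α = β = 0` (`K[A]` is a domain); `tr`, `det` of a `⋆`-symmetric element are `σ`-fixed.
* §2 `A⋆ = A⁻¹ = (tr A − A)∕det A ∈ K[A]`, so `K[A]` is `⋆`-stable: `(α + βA)⋆ = σα + σβ A⁻¹`.
* §3 **`exists_nonscalar_hermStar_eq_sq_eq_smul`**: there is `κ = α₀ + β₀A` with `β₀ ≠ 0`, `κ⋆ = κ` and `κ² = k₀ · 1`, `σ k₀ = k₀` (`ξ = A + A⁻¹` or, if `ξ` is scalar,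
  `η = δ(A − A⁻¹)` with `σδ = −δ`; then complete the square `κ = ξ − (tr ξ∕2)`) — `K[A]^⋆ = K^σ ⊕ K^σ κ ≅ K^σ(√k₀)` is Rogawski's `K`.
* §4 Coordinates on `κ`: `α + βA = α′ + β′κ`; `(α′ + β′κ)⋆ = σα′ + σβ′ κ`; `⋆`-fixed iff `σα′ = α′ ∧ σβ′ = β′`; `det (α′ + β′κ) = α′² − k₀ β′²` (`tr κ = 0`).
The COUNT at a non-split place is the sequel `LocalStableClassesNonsplitTypeTwoCount` (over ★ `HilbertSymbolRegularQuadraticExtension` applied to `K^σ(√k₀)`).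

## References
* [Rogawski1990] J. D. Rogawski, *Automorphic Representations of Unitary Groups in Three Variables*, Ann. of Math. Stud. 123 (1990), §3.5 Prop. 3.5.2 p. 29,
  §3.6 p. 31.
* [Kottwitz1986] R. E. Kottwitz, *Stable trace formula: elliptic singular terms*, Math. Ann. 275 (1986), §7.
-/

set_option autoImplicit false

noncomputable section

open Matrix
open scoped MatrixGroups

namespace Literature.NumberTheory.Rogawski1990

variable {K : Type*} [Field K] (σ : K →+* K) (G : Matrix (Fin 2) (Fin 2) K)

/-! ## §1 `K[A] = {α + βA}` is a commutative domain -/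

/-- `det (α + βA) = α² + αβ · tr A + β² · det A` for `A ∈ M₂(K)`. [cite: HornJohnson2013, §0.8.2 (adjugate, determinant of a 2 × 2 matrix)] -/
theorem det_smul_one_add_smul (A : Matrix (Fin 2) (Fin 2) K) (α β : K) :
    (α • (1 : Matrix (Fin 2) (Fin 2) K) + β • A).det = α ^ 2 + α * β * A.trace + β ^ 2 * A.det := by
  simp only [det_fin_two, trace_fin_two, Matrix.add_apply, Matrix.smul_apply, Matrix.one_apply_eq,
    Matrix.one_apply_ne (by decide : (0 : Fin 2) ≠ 1), Matrix.one_apply_ne (by decide : (1 : Fin 2) ≠ 0), smul_eq_mul, mul_one, mul_zero]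
  ring

/-- `tr (α + βA) = 2α + β · tr A`. [cite: HornJohnson2013, §0.8.2 (adjugate, determinant of a 2 × 2 matrix)] -/
theorem trace_smul_one_add_smul (A : Matrix (Fin 2) (Fin 2) K) (α β : K) :
    (α • (1 : Matrix (Fin 2) (Fin 2) K) + β • A).trace = 2 * α + β * A.trace := by
  simp only [trace_fin_two, Matrix.add_apply, Matrix.smul_apply, Matrix.one_apply_eq, smul_eq_mul, mul_one]
  ring

/-- **`K[A]` is a domain** when `χ_A` has no root in `K`: `det (α + βA) = 0 ⇒ α = β = 0` (`β ≠ 0` would make `−α∕β` a root of `χ_A`).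
[cite: Rogawski1990, §3.6 p. 31] -/
theorem eq_zero_of_det_smul_one_add_smul_eq_zero {A : Matrix (Fin 2) (Fin 2) K} (hA : ∀ c : K, A.charpoly.eval c ≠ 0) {α β : K}
    (h : (α • (1 : Matrix (Fin 2) (Fin 2) K) + β • A).det = 0) : α = 0 ∧ β = 0 := by
  by_cases hβ : β = 0
  · rw [hβ, zero_smul, add_zero, det_smul, det_one, mul_one, Fintype.card_fin] at h
    exact ⟨(pow_eq_zero_iff two_ne_zero).mp h, hβ⟩
  · exfalso
    apply hA (-α / β)
    rw [eval_charpoly]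
    -- `scalar (−α∕β) − A = −β⁻¹ • (α + βA)`
    have hmat : Matrix.scalar (Fin 2) (-α / β) - A = (-β⁻¹) • (α • (1 : Matrix (Fin 2) (Fin 2) K) + β • A) := by
      rw [scalar_apply, ← smul_one_eq_diagonal, smul_add, smul_smul, smul_smul, show -β⁻¹ * β = -1 by field_simp, neg_one_smul,
        show -β⁻¹ * α = -α / β by field_simp, sub_eq_add_neg]
    rw [hmat, det_smul, h, mul_zero]

/-- Non-zero elements of `K[A]` are invertible (`χ_A` without roots). [cite: Rogawski1990, §3.6 p. 31] -/
theorem det_smul_one_add_smul_ne_zero {A : Matrix (Fin 2) (Fin 2) K} (hA : ∀ c : K, A.charpoly.eval c ≠ 0) {α β : K} (h : α ≠ 0 ∨ β ≠ 0) :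
    (α • (1 : Matrix (Fin 2) (Fin 2) K) + β • A).det ≠ 0 := by
  intro h0
  obtain ⟨hα, hβ⟩ := eq_zero_of_det_smul_one_add_smul_eq_zero hA h0
  rcases h with h | h
  · exact h hα
  · exact h hβ

/-- The coordinates on `1, A` are unique when `A` is not scalar: `α + βA = α′ + β′A ⇒ α = α′ ∧ β = β′`. [cite: Rogawski1990, §3.6 p. 31] -/
theorem smul_one_add_smul_inj {A : Matrix (Fin 2) (Fin 2) K} (hA : ∀ c : K, A ≠ c • 1) {α β α' β' : K}
    (h : α • (1 : Matrix (Fin 2) (Fin 2) K) + β • A = α' • 1 + β' • A) : α = α' ∧ β = β' := by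
  have h1 : (β - β') • A = (α' - α) • (1 : Matrix (Fin 2) (Fin 2) K) := by
    rw [sub_smul, sub_smul, sub_eq_sub_iff_add_eq_add, add_comm, h]
  by_cases hβ : β - β' = 0
  · rw [hβ, zero_smul, eq_comm, smul_eq_zero] at h1
    rcases h1 with h1 | h1
    · exact ⟨(sub_eq_zero.mp h1).symm, sub_eq_zero.mp hβ⟩
    · exact absurd h1 one_ne_zero
  · exfalso
    apply hA ((β - β')⁻¹ * (α' - α))
    rw [← smul_smul, ← h1, smul_smul, inv_mul_cancel₀ hβ, one_smul]

/-- A matrix without eigenvalues is not scalar. [cite: Rogawski1990, §3.6 p. 31] -/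
theorem ne_smul_one_of_eval_charpoly_ne_zero {A : Matrix (Fin 2) (Fin 2) K} (hA : ∀ c : K, A.charpoly.eval c ≠ 0) (c : K) : A ≠ c • 1 := by
  intro h
  apply hA c
  rw [eval_charpoly, h, scalar_apply, ← smul_one_eq_diagonal, sub_self, det_zero]

/-- `det (x⋆) = σ (det x)` and `tr (x⋆) = σ (tr x)` for the `G`-adjoint (`G` invertible), so a `⋆`-symmetric `x` has `σ`-fixed `det` and `tr`.
[cite: Rogawski1990, §3.5 p. 29] -/
theorem det_trace_fixed_of_hermStar_eq_self (hG : IsUnit G.det) {x : Matrix (Fin 2) (Fin 2) K} (hx : hermStar σ G x = x) :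
    σ x.det = x.det ∧ σ x.trace = x.trace := by
  constructor
  · have h : (hermStar σ G x).det = σ x.det := by
      rw [hermStar_def, Matrix.det_mul, Matrix.det_mul, det_transpose, show (x.map σ).det = σ x.det from (RingHom.map_det σ x).symm,
        mul_right_comm, Matrix.det_nonsing_inv_mul_det G hG, one_mul]
    rw [← h, hx]
  · have h : (hermStar σ G x).trace = σ x.trace := by
      rw [hermStar_def, Matrix.mul_assoc, trace_mul_comm, Matrix.mul_assoc, Matrix.mul_nonsing_inv G hG, Matrix.mul_one, trace_transpose,
        ← AddMonoidHom.map_trace]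
    rw [← h, hx]

/-! ## §2 `A⋆ = A⁻¹ ∈ K[A]`: the algebra `K[A]` is `⋆`-stable -/

/-- **Cayley–Hamilton for `2 × 2`**: `(tr A • 1 − A) · A = det A • 1`. [cite: HornJohnson2013, Thm. 2.4.3.2 (Cayley–Hamilton)] -/
theorem trace_smul_one_sub_mul_self (A : Matrix (Fin 2) (Fin 2) K) :
    (A.trace • (1 : Matrix (Fin 2) (Fin 2) K) - A) * A = A.det • (1 : Matrix (Fin 2) (Fin 2) K) := by
  ext i j
  fin_cases i <;> fin_cases j <;>
    simp [Matrix.mul_apply, Fin.sum_univ_two, det_fin_two, trace_fin_two, one_apply_ne (by decide : (0 : Fin 2) ≠ 1),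
      one_apply_ne (by decide : (1 : Fin 2) ≠ 0)] <;> ring

/-- Hence `A⁻¹ = (det A)⁻¹ • (tr A • 1 − A) ∈ K[A]` (`det A ≠ 0`). [cite: HornJohnson2013, §0.8.2 (adjugate and inverse)] -/
theorem inv_eq_smul_trace_smul_one_sub {A : Matrix (Fin 2) (Fin 2) K} (hA : A.det ≠ 0) :
    A⁻¹ = A.det⁻¹ • (A.trace • (1 : Matrix (Fin 2) (Fin 2) K) - A) := by
  apply Matrix.inv_eq_left_inv
  rw [smul_mul_assoc, trace_smul_one_sub_mul_self, smul_smul, inv_mul_cancel₀ hA, one_smul]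

/-- `A⁻¹ = (tr A ∕ det A) • 1 + (−1∕det A) • A` as an element of `K[A]`. [cite: HornJohnson2013, §0.8.2 (adjugate and inverse)] -/
theorem inv_eq_smul_one_add_smul {A : Matrix (Fin 2) (Fin 2) K} (hA : A.det ≠ 0) :
    A⁻¹ = (A.det⁻¹ * A.trace) • (1 : Matrix (Fin 2) (Fin 2) K) + (-A.det⁻¹) • A := by
  rw [inv_eq_smul_trace_smul_one_sub hA, smul_sub, smul_smul, neg_smul, sub_eq_add_neg]

/-- For `A` unitary for `G` (`ᵗ(σA) G A = G`, `G` invertible): `A⋆_G = A⁻¹`. [cite: Rogawski1990, §3.1 p. 19] -/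
theorem hermStar_eq_inv_of_unitary (hG : IsUnit G.det) {A : Matrix (Fin 2) (Fin 2) K} (hAu : (A.map σ)ᵀ * G * A = G) :
    hermStar σ G A = A⁻¹ := by
  have h1 : hermStar σ G A * A = 1 := by
    rw [hermStar_def, Matrix.mul_assoc, Matrix.mul_assoc, ← Matrix.mul_assoc ((A.map σ)ᵀ), hAu, Matrix.nonsing_inv_mul G hG]
  exact (Matrix.inv_eq_left_inv h1).symm

/-- **`K[A]` is `⋆`-stable**: `(α + βA)⋆ = σα • 1 + σβ • A⁻¹ = (σα + σβ tr A∕det A) • 1 − (σβ∕det A) • A` for `A` unitary for `G`.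
[cite: Rogawski1990, §3.5 Prop. 3.5.2 (a) p. 29] -/
theorem hermStar_smul_one_add_smul (hG : IsUnit G.det) {A : Matrix (Fin 2) (Fin 2) K} (hA : A.det ≠ 0) (hAu : (A.map σ)ᵀ * G * A = G) (α β : K) :
    hermStar σ G (α • (1 : Matrix (Fin 2) (Fin 2) K) + β • A) =
      (σ α + σ β * (A.det⁻¹ * A.trace)) • (1 : Matrix (Fin 2) (Fin 2) K) + (-(σ β * A.det⁻¹)) • A := by
  rw [hermStar_add, hermStar_smul, hermStar_smul, hermStar_one σ G hG, hermStar_eq_inv_of_unitary σ G hG hAu, inv_eq_smul_one_add_smul hA,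
    smul_add, smul_smul, smul_smul, add_smul, mul_neg, add_assoc]

/-! ## §3 A non-scalar `⋆`-fixed square-root generator `κ` of `K[A]` -/

/-- **Completing the square in `K[A]`**: a `⋆`-fixed `ξ = α + βA` yields `κ := ξ − (tr ξ∕2) • 1 = α₀ + βA` (same `β`), `⋆`-fixed, with `κ² = k₀ • 1`,
`k₀ = (tr ξ)²∕4 − det ξ` `σ`-fixed (`2 ≠ 0`; `G` invertible, so that `det ξ`, `tr ξ` are `σ`-fixed). [cite: Rogawski1990, §3.6 p. 31] -/
theorem exists_sq_eq_smul_one_of_hermStar_eq_self (hG : IsUnit G.det) (h2 : (2 : K) ≠ 0) {A : Matrix (Fin 2) (Fin 2) K} {α β : K}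
    (hfix : hermStar σ G (α • (1 : Matrix (Fin 2) (Fin 2) K) + β • A) = α • 1 + β • A) :
    ∃ α₀ k₀ : K, hermStar σ G (α₀ • (1 : Matrix (Fin 2) (Fin 2) K) + β • A) = α₀ • 1 + β • A ∧
      (α₀ • (1 : Matrix (Fin 2) (Fin 2) K) + β • A) * (α₀ • 1 + β • A) = k₀ • (1 : Matrix (Fin 2) (Fin 2) K) ∧ σ k₀ = k₀ := by
  set ξ : Matrix (Fin 2) (Fin 2) K := α • 1 + β • A with hξ
  obtain ⟨hdet, htr⟩ := det_trace_fixed_of_hermStar_eq_self σ G hG hfix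
  have hσ2 : σ 2⁻¹ = 2⁻¹ := by rw [map_inv₀, map_ofNat]
  refine ⟨α - 2⁻¹ * ξ.trace, (2⁻¹ * ξ.trace) ^ 2 - ξ.det, ?_, ?_, ?_⟩
  · -- `κ = ξ − (tr ξ/2) • 1` is `⋆`-fixed
    have e : (α - 2⁻¹ * ξ.trace) • (1 : Matrix (Fin 2) (Fin 2) K) + β • A = ξ + (-(2⁻¹ * ξ.trace)) • 1 := by
      rw [hξ, sub_smul, neg_smul]; abel
    rw [e, hermStar_add, hfix, hermStar_smul, hermStar_one σ G hG, map_neg, map_mul, hσ2, htr]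
  · -- Cayley–Hamilton: `κ² = ((tr ξ)²/4 − det ξ) • 1` since `tr κ = 0`
    have e : (α - 2⁻¹ * ξ.trace) • (1 : Matrix (Fin 2) (Fin 2) K) + β • A = ξ - (2⁻¹ * ξ.trace) • 1 := by
      rw [hξ, sub_smul]; abel
    rw [e]
    -- entrywise Cayley–Hamilton: `(ξ − c)(ξ − c) = (c² − det ξ) • 1` with `c = tr ξ / 2`
    ext i j
    fin_cases i <;> fin_cases j <;>
      simp [Matrix.mul_apply, Fin.sum_univ_two, det_fin_two, trace_fin_two, Matrix.one_apply_ne (by decide : (0 : Fin 2) ≠ 1),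
        Matrix.one_apply_ne (by decide : (1 : Fin 2) ≠ 0)] <;> field_simp <;> ring
  · rw [map_sub, map_pow, map_mul, hσ2, htr, hdet]

/-- **A non-scalar `⋆`-fixed square-root generator of `K[A]`**: for `A` unitary for the hermitian invertible `G` with `χ_A` rootless, `σ` an involution with
`σδ = −δ ≠ 0` and `2 ≠ 0`, there is `κ = α₀ + β₀A`, `β₀ ≠ 0`, with `κ⋆ = κ` and `κ² = k₀ • 1`, `σk₀ = k₀` — from `ξ = A + A⋆ = (tr A∕det A) + (1 − 1∕det A) A`
when `det A ≠ 1`, else from `η = δ(A − A⋆) = −δ tr A + 2δ A` (both `⋆`-fixed), completing the square (§3).  `K[A]^⋆ = K^σ ⊕ K^σκ ≅ K^σ(√k₀)` is the field `K`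
of [Rogawski1990, §3.6] type (2). [cite: Rogawski1990, §3.6 p. 31; §3.5 Prop. 3.5.2 (a) p. 29] -/
theorem exists_nonscalar_hermStar_eq_sq_eq_smul (hσ : ∀ r : K, σ (σ r) = r) (hGh : (G.map σ)ᵀ = G) (hG : IsUnit G.det) (h2 : (2 : K) ≠ 0)
    {δ : K} (hδσ : σ δ = -δ) (hδ : δ ≠ 0) {A : Matrix (Fin 2) (Fin 2) K} (hA : ∀ c : K, A.charpoly.eval c ≠ 0) (hAu : (A.map σ)ᵀ * G * A = G) :
    ∃ α₀ β₀ k₀ : K, β₀ ≠ 0 ∧ hermStar σ G (α₀ • (1 : Matrix (Fin 2) (Fin 2) K) + β₀ • A) = α₀ • 1 + β₀ • A ∧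
      (α₀ • (1 : Matrix (Fin 2) (Fin 2) K) + β₀ • A) * (α₀ • 1 + β₀ • A) = k₀ • (1 : Matrix (Fin 2) (Fin 2) K) ∧ σ k₀ = k₀ := by
  have hAd : A.det ≠ 0 := by
    have h := det_smul_one_add_smul_ne_zero hA (α := 0) (β := 1) (Or.inr one_ne_zero)
    rwa [zero_smul, zero_add, one_smul] at h
  have hAA : hermStar σ G (hermStar σ G A) = A := hermStar_hermStar σ G hG hσ hGh A
  have hstarA : hermStar σ G A = (A.det⁻¹ * A.trace) • (1 : Matrix (Fin 2) (Fin 2) K) + (-A.det⁻¹) • A := by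
    rw [hermStar_eq_inv_of_unitary σ G hG hAu, inv_eq_smul_one_add_smul hAd]
  by_cases hd1 : A.det = 1
  · -- `η = δ • A + (−δ) • A⋆ = (−δ tr A) • 1 + (2δ) • A`
    have hη : hermStar σ G ((-(δ * A.trace)) • (1 : Matrix (Fin 2) (Fin 2) K) + (2 * δ) • A) = (-(δ * A.trace)) • 1 + (2 * δ) • A := by
      have e : (-(δ * A.trace)) • (1 : Matrix (Fin 2) (Fin 2) K) + (2 * δ) • A = δ • A + (-δ) • hermStar σ G A := by
        rw [hstarA, hd1, inv_one, one_mul]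
        module
      rw [e, hermStar_add, hermStar_smul, hermStar_smul, hAA, hδσ, map_neg, hδσ, neg_neg, add_comm]
    obtain ⟨α₀, k₀, h1, h2', h3⟩ := exists_sq_eq_smul_one_of_hermStar_eq_self σ G hG h2 hη
    exact ⟨α₀, 2 * δ, k₀, mul_ne_zero h2 hδ, h1, h2', h3⟩
  · -- `ξ = A + A⋆ = (tr A / det A) • 1 + (1 − 1/det A) • A`
    have hβ : 1 - A.det⁻¹ ≠ 0 := by
      intro h
      apply hd1
      have : A.det⁻¹ = 1 := by linear_combination -h
      rw [← inv_inv A.det, this, inv_one]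
    have hξ : hermStar σ G ((A.det⁻¹ * A.trace) • (1 : Matrix (Fin 2) (Fin 2) K) + (1 - A.det⁻¹) • A) =
        (A.det⁻¹ * A.trace) • 1 + (1 - A.det⁻¹) • A := by
      have e : (A.det⁻¹ * A.trace) • (1 : Matrix (Fin 2) (Fin 2) K) + (1 - A.det⁻¹) • A = A + hermStar σ G A := by
        rw [hstarA]
        module
      rw [e, hermStar_add, hAA, add_comm]
    obtain ⟨α₀, k₀, h1, h2', h3⟩ := exists_sq_eq_smul_one_of_hermStar_eq_self σ G hG h2 hξ
    exact ⟨α₀, 1 - A.det⁻¹, k₀, hβ, h1, h2', h3⟩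

/-! ## §4 Coordinates on `1, κ`: the `⋆`-fixed part `K^σ ⊕ K^σ κ`, the norm form `α′² − k₀β′²` -/

section Kappa

variable {A κ : Matrix (Fin 2) (Fin 2) K} {α₀ β₀ k₀ : K}

/-- Change of coordinates: `α + βA = (α − βα₀∕β₀) + (β∕β₀) κ` for `κ = α₀ + β₀A`, `β₀ ≠ 0`. [cite: Rogawski1990, §3.6 p. 31] -/
theorem exists_eq_smul_one_add_smul_kappa (hκ : κ = α₀ • (1 : Matrix (Fin 2) (Fin 2) K) + β₀ • A) (hβ₀ : β₀ ≠ 0) (α β : K) :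
    ∃ α' β' : K, α • (1 : Matrix (Fin 2) (Fin 2) K) + β • A = α' • 1 + β' • κ := by
  refine ⟨α - β * β₀⁻¹ * α₀, β * β₀⁻¹, ?_⟩
  rw [hκ, smul_add, smul_smul, smul_smul, inv_mul_cancel_right₀ hβ₀, sub_smul]
  abel

/-- `κ = α₀ + β₀A` (`β₀ ≠ 0`) is not scalar when `A` is not. [cite: Rogawski1990, §3.6 p. 31] -/
theorem kappa_ne_smul_one (hκ : κ = α₀ • (1 : Matrix (Fin 2) (Fin 2) K) + β₀ • A) (hβ₀ : β₀ ≠ 0) (hA : ∀ c : K, A ≠ c • 1) (c : K) : κ ≠ c • 1 := by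
  intro h
  apply hA (β₀⁻¹ * (c - α₀))
  rw [← smul_smul, sub_smul, ← h, hκ, add_sub_cancel_left, smul_smul, inv_mul_cancel₀ hβ₀, one_smul]

/-- `(α′ + β′κ)⋆ = σα′ + σβ′ κ` for `κ⋆ = κ` (`G` invertible). [cite: Rogawski1990, §3.5 Prop. 3.5.2 (a) p. 29] -/
theorem hermStar_smul_one_add_smul_kappa (hG : IsUnit G.det) (hκs : hermStar σ G κ = κ) (α' β' : K) :
    hermStar σ G (α' • (1 : Matrix (Fin 2) (Fin 2) K) + β' • κ) = σ α' • 1 + σ β' • κ := by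
  rw [hermStar_add, hermStar_smul, hermStar_smul, hermStar_one σ G hG, hκs]

/-- **The `⋆`-fixed part of `K[A]` is `K^σ ⊕ K^σ κ`**: `(α′ + β′κ)⋆ = α′ + β′κ ↔ σα′ = α′ ∧ σβ′ = β′` (`κ` non-scalar `⋆`-fixed).
[cite: Rogawski1990, §3.5 Prop. 3.5.2 (a) p. 29] -/
theorem hermStar_smul_one_add_smul_kappa_eq_self_iff (hG : IsUnit G.det) (hκs : hermStar σ G κ = κ) (hκ : ∀ c : K, κ ≠ c • 1) (α' β' : K) :
    hermStar σ G (α' • (1 : Matrix (Fin 2) (Fin 2) K) + β' • κ) = α' • 1 + β' • κ ↔ σ α' = α' ∧ σ β' = β' := by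
  rw [hermStar_smul_one_add_smul_kappa σ G hG hκs]
  constructor
  · exact fun h => smul_one_add_smul_inj hκ h
  · rintro ⟨h1, h2⟩
    rw [h1, h2]

/-- `κ² = k₀ • 1` with `κ` non-scalar forces `tr κ = 0` and `det κ = −k₀` (Cayley–Hamilton). [cite: HornJohnson2013, Thm. 2.4.3.2 (Cayley–Hamilton)] -/
theorem trace_eq_zero_and_det_eq_of_sq (hsq : κ * κ = k₀ • (1 : Matrix (Fin 2) (Fin 2) K)) (hκ : ∀ c : K, κ ≠ c • 1) :
    κ.trace = 0 ∧ κ.det = -k₀ := by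
  have hCH := trace_smul_one_sub_mul_self κ
  rw [sub_mul, smul_mul_assoc, Matrix.one_mul, hsq, sub_eq_iff_eq_add, ← add_smul] at hCH
  -- `tr κ • κ = (det κ + k₀) • 1`
  have htr : κ.trace = 0 := by
    by_contra h
    apply hκ (κ.trace⁻¹ * (κ.det + k₀))
    rw [← smul_smul, ← hCH, smul_smul, inv_mul_cancel₀ h, one_smul]
  refine ⟨htr, ?_⟩
  rw [htr, zero_smul, eq_comm, smul_eq_zero] at hCH
  rcases hCH with h | h
  · linear_combination h
  · exact absurd h one_ne_zero

/-- **The norm form on `K^σ ⊕ K^σ κ`**: `det (α′ + β′κ) = α′² − k₀β′²` (`κ² = k₀`, `κ` non-scalar). [cite: Rogawski1990, §3.5 Prop. 3.5.2 (a) p. 29] -/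
theorem det_smul_one_add_smul_kappa (hsq : κ * κ = k₀ • (1 : Matrix (Fin 2) (Fin 2) K)) (hκ : ∀ c : K, κ ≠ c • 1) (α' β' : K) :
    (α' • (1 : Matrix (Fin 2) (Fin 2) K) + β' • κ).det = α' ^ 2 - k₀ * β' ^ 2 := by
  obtain ⟨htr, hdet⟩ := trace_eq_zero_and_det_eq_of_sq hsq hκ
  rw [det_smul_one_add_smul, htr, hdet]
  ring

/-- Multiplication in the coordinates `1, κ` (`κ² = k₀`): `(a + bκ)(a′ + b′κ) = (aa′ + k₀bb′) + (ab′ + ba′)κ` — the law of `QuadraticAlgebra K k₀ 0`. [cite: Rogawski1990, §3.6 p. 31] -/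
theorem smul_one_add_smul_kappa_mul (hsq : κ * κ = k₀ • (1 : Matrix (Fin 2) (Fin 2) K)) (a b a' b' : K) :
    (a • (1 : Matrix (Fin 2) (Fin 2) K) + b • κ) * (a' • 1 + b' • κ) = (a * a' + k₀ * b * b') • 1 + (a * b' + b * a') • κ := by
  rw [add_mul, mul_add, mul_add, smul_mul_smul_comm, Matrix.one_mul, smul_mul_smul_comm, Matrix.one_mul, smul_mul_smul_comm, Matrix.mul_one,
    smul_mul_smul_comm, hsq, smul_smul, add_smul, add_smul]
  module

/-- `k₀` is not a square in `K`: `k₀ = c²` would give `(κ − c)(κ + c) = 0` in the domain `K[A]`, so `κ = ±c` scalar. [cite: Rogawski1990, §3.6 p. 31] -/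
theorem not_isSquare_of_kappa (hA : ∀ c : K, A.charpoly.eval c ≠ 0) (hκ₀ : κ = α₀ • (1 : Matrix (Fin 2) (Fin 2) K) + β₀ • A) (hβ₀ : β₀ ≠ 0)
    (hsq : κ * κ = k₀ • (1 : Matrix (Fin 2) (Fin 2) K)) : ¬ IsSquare k₀ := by
  rintro ⟨c, hc⟩
  subst hc
  -- `(κ − c)(κ + c) = 0`
  have hprod : ((α₀ - c) • (1 : Matrix (Fin 2) (Fin 2) K) + β₀ • A) * ((α₀ + c) • 1 + β₀ • A) = 0 := by
    have e1 : (α₀ - c) • (1 : Matrix (Fin 2) (Fin 2) K) + β₀ • A = κ - c • 1 := by rw [hκ₀, sub_smul]; abel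
    have e2 : (α₀ + c) • (1 : Matrix (Fin 2) (Fin 2) K) + β₀ • A = κ + c • 1 := by rw [hκ₀, add_smul]; abel
    rw [e1, e2, sub_mul, mul_add, mul_add, hsq, mul_smul_comm, Matrix.mul_one, smul_mul_assoc, Matrix.one_mul, smul_mul_assoc, Matrix.one_mul,
      smul_smul]
    abel
  have hdet := congrArg Matrix.det hprod
  rw [Matrix.det_mul, det_zero, mul_eq_zero] at hdet
  rcases hdet with h | h
  · exact hβ₀ (eq_zero_of_det_smul_one_add_smul_eq_zero hA h).2
  · exact hβ₀ (eq_zero_of_det_smul_one_add_smul_eq_zero hA h).2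

end Kappa

end Literature.NumberTheory.Rogawski1990
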